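import Summits.QuantumFields.YangMills.Theorems.BalabanUVNodesN22W1RelCentredSliceInputsL2U
import Literature.MathematicalPhysics.QuantumFieldTheory.Balaban1983to89.Node00.HistoryTermDatum214WilsonActionReading

/-!
# BalabanUVNodes ∕ node N22 = NE9 — THE RELATIVE-DISC CENTRED ROAD OVER THE ADMISSIBLE CLASS, MODULE J22: THE WILSON HALF OF `SliceInputsL2U` — LEMMA 2's SENTENCE ([I] (2.8),
# [II] (1.38)–(1.39)) AND THE THREE QUALITATIVE LAWS, ALL EIGHT WILSON FIELDS — READ OFF ONE ANALYTIC LOCALIZED ACTION READING BY NAME (node00-def-W1 W1-17d `LocActionC` ∕ `wilsonC` ∕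
# `WilsonOfActionOn` ∕ `readWilsonC`; module J20's twin for the Wilson half)

Cell `pub-ymgap`, HUMAN RULING D-0062 (Track A) ∕ D-0149 width seats (director-ym №197), WIDTH SEAT `pub-ymgap-dag-n22-w3` (gen 0) on dag-n22-c g10's hand-out «w3 take J22» (pub-ymgap INBOX
l.24541), file J22 of the s1 line.  THEOREMS ONLY (0 `def`, 0 `sorry`); imports J17-D `…SliceInputsL2U` (the record whose Wilson block this file supplies) and node00-def-W1 W1-17d
`Node00/HistoryTermDatum214WilsonActionReading` (`TermDatum214.LocActionC` — the Y-localized term of the effective action read in the complexified unscaled field —, `wilsonC 𝒜 := rem₃C ∘ 𝒜`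
(print's «terms of at least third order» `V`), the laws `LocActionC.JointHoloOn ∕ FieldHoloOn ∕ SupBoundOn ∕ LocalInC ∕ RealSliceMeasurable`, the letter `wilsonSupBound M𝒜 = 8·M𝒜`, the datum-level
reading `readWilsonC`, the schema `WilsonOfActionOn Wc Z t 𝒜 W 𝔅c` with its transfer faces) BY NAME.  `--supports` K3⁷ `SpineGivenEndpointR13SepCoPH` (stmt-QuantumFields-20544) as a helper; COUNT-NEUTRAL.

WHY.  Module J17-D `SliceInputsL2U` asks of the Wilson remainder `𝒲(ξ; Y, ·)` of the unscaled-field law EIGHT things: Lemma 2's sentence per configuration — a complex extension `Wc Z t ξ Y` on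
the sup-ball with the real-slice identity (`h𝒲re`), analyticity (`hWd`), a sup bound UNIFORM on the thickening (`hWM`) with a signed letter (`hM𝒲`), the third-order onset (`hWB`, [I] (2.8)) —
and the qualitative laws `h𝒲m h𝒲d hlocY𝒲`.  Print's `V(H₁B′)` is the third-order remainder of the localized action `𝒜(ξ; Y, ·)`, an analytic function of `(U, J, B′)` ([II] p.10), so ONE analytic
action reading carries all eight: THIS FILE reads them off W1-17d's `WilsonOfActionOn Wc Z t 𝒜 W 𝔅c` on a field set `𝔅c ⊇ ball 0 RA` containing the reals.
* §1 `SliceInputsL2U.wilsonLemma2_of_wilsonOfActionOn` — the five Lemma-2 Wilson fields in J17-D's binder shapes (:396 ∕ :400 ∕ :402 ∕ :404 ∕ :406) at `𝒲 := 𝔇.realSliceWilson Wc`, radius `RA`,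
  letter `M𝒲 := wilsonSupBound M𝒜`: `hM𝒲` (`wilsonSupBound_nonneg`), `h𝒲re` (`rfl`), `hWd` (`WilsonOfActionOn.differentiableOn_field`, `.mono`), `hWM` (`.norm_le`), `hWB` (`.beginsAt`).
* §2 ★ `SliceInputsL2U.wilsonBlock_of_wilsonOfActionOn` — ALL EIGHT at once: §1 ∧ `h𝒲m` (`measurable_wilsonC_realSlice`), `h𝒲d` (`differentiableOn_wilsonC_config`, real-slice edition, from JOINT
  holomorphy on `W ×ˢ 𝔅c`), `hlocY𝒲` (`wilsonC_local`), transported along the schema at the real fields (`h𝔅 : ∀ A, ofRealVec A ∈ 𝔅c`).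
* §3 `SliceInputsL2U.wilsonBlock_readWilsonC` — the same for the READ PAIR `𝒲 := 𝔇.realSliceWilson (𝔇.readWilsonC 𝒜c)`, `Wc := 𝔇.readWilsonC 𝒜c` from the laws of `𝒜c Z t` alone.

* §4 (A6, №189) `SliceInputsL2U.wilsonBlock_hypotheses_inhabited` — the eleven hypotheses of §2 jointly inhabited by the DEGENERATE zero action (inhabitation is not content).

HONEST FRAMING.  Count-neutral transfer (projections of W1-17d's faces; the mathematics — the third-order remainder of an analytic map begins at order three and inherits the Cauchy
estimates of the jet — is W1-17d's `W1.Jet3`, cited); nothing of Bałaban's action is constructed: the analytic localized action OF RECORD `𝒜c` WITH its laws at the datum of record (joint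
analyticity on `W ×ˢ 𝔅c`, the sup letter `M𝒜(Y)` — whose decay (1.39) in `|Y∖□|` is the producer's —, locality, real-slice measurability) is NODE A's; no (1.39)–(1.40) ∕ (1.43) ∕ [I]
(2.6)–(2.11) estimate claimed; the older-terms half is module J20's and untouched; N22 NOT discharged (typed 28∕28 · discharged 5∕27 UNCHANGED, A 5∕28); no count claim (the chair's count
line is the only count); one finite four-torus programme at fixed ε — R4 closes the CONDITIONAL rung `BalabanLadder.UV` only; the Yang–Mills mass gap (Clay) is NOT proved by any of this;
NOT infinite volume, NOT OS on ℝ⁴, NOT a mass gap.  0 `sorry`, 0 `def`, standard axioms.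

References (TYPES ∕ loci only): [II] = [Balaban1988RG2Cluster] (1.37)–(1.39) p. 10, Lemma 2 (1.41)–(1.43) p. 11, (2.2)–(2.3) p. 12, (2.14) p. 15 ll. 19–20; [I] = [Balaban1987RG1]
(2.6)–(2.8) p. 266, (3.10) p. 272.
-/

noncomputable section

namespace YMDAG.N22.W1

open Set Metric
open scoped BigOperators
open Literature.MathematicalPhysics.QuantumFieldTheory.Balaban1983to89
open Literature.MathematicalPhysics.QuantumFieldTheory.Balaban1983to89.TreeLengthTorus (TPt TDom tsys torusTreeLen)
open Literature.MathematicalPhysics.QuantumFieldTheory.Balaban1983to89.Node00.Sect2 (domSys domCount CPair)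
open Literature.MathematicalPhysics.QuantumFieldTheory.Balaban1983to89.Node00.W1
open Literature.MathematicalPhysics.QuantumFieldTheory.Balaban1983to89.B13ExpansionOrder (BeginsAt)
open Literature.MathematicalPhysics.QuantumFieldTheory.Balaban1983to89.B13Lemma2LeadingParts (ofRealVec)

namespace SliceInputsL2U

variable {c₀ : B13.Consts} {P : Params} {𝔸 : Type*} [NormedRing 𝔸] [NormedAlgebra ℂ 𝔸] {M k L : ℕ} [NeZero L]
  {𝔇 : TermDatum214 c₀ P 𝔸 M k L}
  (Z : (domSys P M (k + 1)).Dom) (t : TermLabel P M k L) {W : Set (CPair P 𝔸)} {𝔅c : Set ((𝔇.𝒦 Z t).Λ → ℂ)} {RA : ℝ}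
  {M𝒜 : TDom P.d (L * domCount P M (k + 1)) → ℝ} {S : TDom P.d (L * domCount P M (k + 1)) → Finset (𝔇.𝒦 Z t).Λ}
  (Wc : 𝔇.ComplexWilson) (𝒜 : 𝔇.LocActionC Z t)

/-! ## §1 The five Lemma-2 Wilson fields from an analytic action reading on an open field set `𝔅c ⊇ ball 0 RA` -/

omit [NormedRing 𝔸] [NormedAlgebra ℂ 𝔸] in
/-- **THE WILSON HALF OF LEMMA 2's SENTENCE IN `SliceInputsL2U`, FROM AN ANALYTIC ACTION READING** (J17-D's `hM𝒲 ∧ h𝒲re ∧ hWd ∧ hWM ∧ hWB` at `𝒲 := realSliceWilson Wc`, radius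
`RA`, letter `M𝒲 := wilsonSupBound M𝒜 = 8·M𝒜`): for an opaque complex Wilson remainder `Wc` that IS, on the thickening `W` and an OPEN field set `𝔅c ⊇ ball 0 RA`, the third-order
remainder `wilsonC 𝒜` of a localized action `𝒜` (W1-17d `WilsonOfActionOn`) analytic in the field on `𝔅c` and sup-bounded by `M𝒜` on `ball 0 RA` (`RA > 0`, `M𝒜 ≥ 0` on `𝐃`) — one W1-17d
face each (`wilsonSupBound_nonneg`, `rfl`, `WilsonOfActionOn.differentiableOn_ball`, `.norm_le`, `.beginsAt`).  (No structure on `𝔸` is used: field-side faces only.) -/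
theorem wilsonLemma2_of_wilsonOfActionOn (h : 𝔇.WilsonOfActionOn Wc Z t 𝒜 W 𝔅c) (h𝔅o : IsOpen 𝔅c) (h𝔅 : ball 0 RA ⊆ 𝔅c) (hRA : 0 < RA)
    (hhol : 𝒜.FieldHoloOn W 𝔅c) (hM : 𝒜.SupBoundOn W RA M𝒜) (hM𝒜 : ∀ Y ∈ t.1, 0 ≤ M𝒜 Y) :
    (∀ Y ∈ t.1, 0 ≤ TermDatum214.wilsonSupBound M𝒜 Y) ∧
    (∀ ξ ∈ W, ∀ (Y : TDom P.d (L * domCount P M (k + 1))) (A : (𝔇.𝒦 Z t).Λ → ℝ), 𝔇.realSliceWilson Wc Z t ξ Y A = Wc Z t ξ Y (ofRealVec A)) ∧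
    (∀ ξ ∈ W, ∀ Y : TDom P.d (L * domCount P M (k + 1)), DifferentiableOn ℂ (Wc Z t ξ Y) (ball 0 RA)) ∧
    (∀ ξ ∈ W, ∀ Y : TDom P.d (L * domCount P M (k + 1)), ∀ z ∈ ball (0 : (𝔇.𝒦 Z t).Λ → ℂ) RA, ‖Wc Z t ξ Y z‖ ≤ TermDatum214.wilsonSupBound M𝒜 Y) ∧
    (∀ ξ ∈ W, ∀ Y : TDom P.d (L * domCount P M (k + 1)), BeginsAt (Wc Z t ξ Y) 3) :=
  ⟨fun Y hY => TermDatum214.wilsonSupBound_nonneg (hM𝒜 Y hY),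
    fun _ _ _ _ => rfl,
    h.differentiableOn_ball h𝔅o hRA h𝔅 hhol,
    h.norm_le hRA h𝔅 hhol hM,
    h.beginsAt h𝔅o hRA h𝔅 hhol hM⟩

/-! ## §2 All eight Wilson fields of `SliceInputsL2U` from ONE analytic action reading (joint analyticity, locality, real-slice measurability) -/

/-- **★ THE WILSON BLOCK OF `SliceInputsL2U`, ALL EIGHT FIELDS, FROM ONE ANALYTIC ACTION READING** on an OPEN thickening `W` and an OPEN field set `𝔅c ⊇ ball 0 RA` containing every
real field (`h𝔅r` — e.g. `𝔅c = univ`, «entire in the field»): with `𝒲 := realSliceWilson Wc` and `M𝒲 := wilsonSupBound M𝒜`, the five Lemma-2 fields of §1 AND the three qualitative laws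
`h𝒲m ∧ h𝒲d ∧ hlocY𝒲` of J17-D (:352 ∕ :354 ∕ :408) for the real slice — measurability from the law `𝒜.RealSliceMeasurable W` (`WilsonOfActionOn.measurable_realSlice`),
configuration-analyticity at every real field from JOINT analyticity `𝒜.JointHoloOn W 𝔅c` (`.differentiableOn_config_realSlice`), `Y`-locality through `S` from `𝒜.LocalInC W S`
(`.local_realSlice`).  The producer of record supplies ONE `LocActionC` with its laws; nothing else of the Wilson block remains. -/
theorem wilsonBlock_of_wilsonOfActionOn (h : 𝔇.WilsonOfActionOn Wc Z t 𝒜 W 𝔅c) (hW : IsOpen W) (h𝔅o : IsOpen 𝔅c) (h𝔅 : ball 0 RA ⊆ 𝔅c)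
    (h𝔅r : ∀ A : (𝔇.𝒦 Z t).Λ → ℝ, ofRealVec A ∈ 𝔅c) (hRA : 0 < RA) (hj : 𝒜.JointHoloOn W 𝔅c) (hM : 𝒜.SupBoundOn W RA M𝒜) (hM𝒜 : ∀ Y ∈ t.1, 0 ≤ M𝒜 Y)
    (hm : 𝒜.RealSliceMeasurable W) (hloc : 𝒜.LocalInC W S) :
    ((∀ Y ∈ t.1, 0 ≤ TermDatum214.wilsonSupBound M𝒜 Y) ∧
      (∀ ξ ∈ W, ∀ (Y : TDom P.d (L * domCount P M (k + 1))) (A : (𝔇.𝒦 Z t).Λ → ℝ), 𝔇.realSliceWilson Wc Z t ξ Y A = Wc Z t ξ Y (ofRealVec A)) ∧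
      (∀ ξ ∈ W, ∀ Y : TDom P.d (L * domCount P M (k + 1)), DifferentiableOn ℂ (Wc Z t ξ Y) (ball 0 RA)) ∧
      (∀ ξ ∈ W, ∀ Y : TDom P.d (L * domCount P M (k + 1)), ∀ z ∈ ball (0 : (𝔇.𝒦 Z t).Λ → ℂ) RA, ‖Wc Z t ξ Y z‖ ≤ TermDatum214.wilsonSupBound M𝒜 Y) ∧
      (∀ ξ ∈ W, ∀ Y : TDom P.d (L * domCount P M (k + 1)), BeginsAt (Wc Z t ξ Y) 3)) ∧
    ((∀ ξ ∈ W, ∀ Y : TDom P.d (L * domCount P M (k + 1)), Measurable (𝔇.realSliceWilson Wc Z t ξ Y)) ∧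
      (∀ (Y : TDom P.d (L * domCount P M (k + 1))) (A : (𝔇.𝒦 Z t).Λ → ℝ), DifferentiableOn ℂ (fun ξ : CPair P 𝔸 => 𝔇.realSliceWilson Wc Z t ξ Y A) W) ∧
      (∀ ξ ∈ W, ∀ Y ∈ t.1, ∀ A A' : (𝔇.𝒦 Z t).Λ → ℝ, (∀ b ∈ S Y, A b = A' b) → 𝔇.realSliceWilson Wc Z t ξ Y A = 𝔇.realSliceWilson Wc Z t ξ Y A')) :=
  ⟨wilsonLemma2_of_wilsonOfActionOn Z t Wc 𝒜 h h𝔅o h𝔅 hRA hj.fieldHoloOn hM hM𝒜,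
    h.measurable_realSlice h𝔅r hRA h𝔅 hj.fieldHoloOn hM hm,
    h.differentiableOn_config_realSlice hW h𝔅o h𝔅r hj,
    h.local_realSlice h𝔅r hloc⟩

/-! ## §3 The read pair: `𝒲 := realSliceWilson (readWilsonC 𝒜c)`, `Wc := readWilsonC 𝒜c` -/

/-- **The same for the READ PAIR** — the Wilson remainder literally read off a family of localized actions (`Wc := 𝔇.readWilsonC 𝒜c`, whose real slice is the law's `𝒲`,
W1-17d `realSliceWilson_readWilsonC_apply`): all eight Wilson fields of `SliceInputsL2U … (𝔇.realSliceWilson (𝔇.readWilsonC 𝒜c)) …` at the slice `(Z, t)` from the laws of `𝒜c Z t` alone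
(`wilsonOfActionOn_readWilsonC` holds on any window and field set). -/
theorem wilsonBlock_readWilsonC (𝒜c : (Z : (domSys P M (k + 1)).Dom) → (t : TermLabel P M k L) → 𝔇.LocActionC Z t) (hW : IsOpen W) (h𝔅o : IsOpen 𝔅c)
    (h𝔅 : ball 0 RA ⊆ 𝔅c) (h𝔅r : ∀ A : (𝔇.𝒦 Z t).Λ → ℝ, ofRealVec A ∈ 𝔅c) (hRA : 0 < RA) (hj : (𝒜c Z t).JointHoloOn W 𝔅c) (hM : (𝒜c Z t).SupBoundOn W RA M𝒜)
    (hM𝒜 : ∀ Y ∈ t.1, 0 ≤ M𝒜 Y) (hm : (𝒜c Z t).RealSliceMeasurable W) (hloc : (𝒜c Z t).LocalInC W S) :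
    ((∀ Y ∈ t.1, 0 ≤ TermDatum214.wilsonSupBound M𝒜 Y) ∧
      (∀ ξ ∈ W, ∀ (Y : TDom P.d (L * domCount P M (k + 1))) (A : (𝔇.𝒦 Z t).Λ → ℝ),
        𝔇.realSliceWilson (𝔇.readWilsonC 𝒜c) Z t ξ Y A = 𝔇.readWilsonC 𝒜c Z t ξ Y (ofRealVec A)) ∧
      (∀ ξ ∈ W, ∀ Y : TDom P.d (L * domCount P M (k + 1)), DifferentiableOn ℂ (𝔇.readWilsonC 𝒜c Z t ξ Y) (ball 0 RA)) ∧
      (∀ ξ ∈ W, ∀ Y : TDom P.d (L * domCount P M (k + 1)), ∀ z ∈ ball (0 : (𝔇.𝒦 Z t).Λ → ℂ) RA, ‖𝔇.readWilsonC 𝒜c Z t ξ Y z‖ ≤ TermDatum214.wilsonSupBound M𝒜 Y) ∧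
      (∀ ξ ∈ W, ∀ Y : TDom P.d (L * domCount P M (k + 1)), BeginsAt (𝔇.readWilsonC 𝒜c Z t ξ Y) 3)) ∧
    ((∀ ξ ∈ W, ∀ Y : TDom P.d (L * domCount P M (k + 1)), Measurable (𝔇.realSliceWilson (𝔇.readWilsonC 𝒜c) Z t ξ Y)) ∧
      (∀ (Y : TDom P.d (L * domCount P M (k + 1))) (A : (𝔇.𝒦 Z t).Λ → ℝ),
        DifferentiableOn ℂ (fun ξ : CPair P 𝔸 => 𝔇.realSliceWilson (𝔇.readWilsonC 𝒜c) Z t ξ Y A) W) ∧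
      (∀ ξ ∈ W, ∀ Y ∈ t.1, ∀ A A' : (𝔇.𝒦 Z t).Λ → ℝ, (∀ b ∈ S Y, A b = A' b) →
        𝔇.realSliceWilson (𝔇.readWilsonC 𝒜c) Z t ξ Y A = 𝔇.realSliceWilson (𝔇.readWilsonC 𝒜c) Z t ξ Y A')) :=
  wilsonBlock_of_wilsonOfActionOn Z t (𝔇.readWilsonC 𝒜c) (𝒜c Z t) (TermDatum214.wilsonOfActionOn_readWilsonC 𝒜c Z t W 𝔅c) hW h𝔅o h𝔅 h𝔅r hRA hj hM hM𝒜 hm hloc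

/-! ## §4 Honesty (standing A6 rule, director-ym №189 ∕ №193): the hypotheses of §2 are JOINTLY INHABITED — by the DEGENERATE zero action -/

/-- **A6: THE ELEVEN HYPOTHESES OF `wilsonBlock_of_wilsonOfActionOn` ARE JOINTLY SATISFIABLE at every slice** — witness: the ZERO localized action (W1-17d's honesty lemmas
`zero_jointHoloOn ∕ zero_supBoundOn ∕ zero_realSliceMeasurable ∕ zero_localInC`), `W := univ`, `𝔅c := univ`, `RA := 1`, `M𝒜 := 0`, `S := ∅`, `Wc := readWilsonC 0` (schema by
`wilsonOfActionOn_readWilsonC`).  INHABITATION IS NOT CONTENT: the theorem is not vacuous, and not thereby substantive — the analytic action OF RECORD with its laws is NODE A's. -/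
theorem wilsonBlock_hypotheses_inhabited :
    ∃ (W : Set (CPair P 𝔸)) (𝔅c : Set ((𝔇.𝒦 Z t).Λ → ℂ)) (RA : ℝ) (M𝒜 : TDom P.d (L * domCount P M (k + 1)) → ℝ)
      (S : TDom P.d (L * domCount P M (k + 1)) → Finset (𝔇.𝒦 Z t).Λ) (Wc : 𝔇.ComplexWilson) (𝒜 : 𝔇.LocActionC Z t),
      𝔇.WilsonOfActionOn Wc Z t 𝒜 W 𝔅c ∧ IsOpen W ∧ IsOpen 𝔅c ∧ ball 0 RA ⊆ 𝔅c ∧ (∀ A : (𝔇.𝒦 Z t).Λ → ℝ, ofRealVec A ∈ 𝔅c) ∧ 0 < RA ∧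
        𝒜.JointHoloOn W 𝔅c ∧ 𝒜.SupBoundOn W RA M𝒜 ∧ (∀ Y ∈ t.1, 0 ≤ M𝒜 Y) ∧ 𝒜.RealSliceMeasurable W ∧ 𝒜.LocalInC W S :=
  ⟨univ, univ, 1, fun _ => 0, fun _ => ∅, 𝔇.readWilsonC fun _ _ => 0, 0,
    TermDatum214.wilsonOfActionOn_readWilsonC (fun _ _ => 0) Z t univ univ, isOpen_univ, isOpen_univ, subset_univ _, fun _ => mem_univ _, one_pos,
    TermDatum214.LocActionC.zero_jointHoloOn univ univ, TermDatum214.LocActionC.zero_supBoundOn univ 1, fun _ _ => le_rfl,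
    TermDatum214.LocActionC.zero_realSliceMeasurable univ, TermDatum214.LocActionC.zero_localInC univ _⟩

end SliceInputsL2U

end YMDAG.N22.W1

end
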